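import Literature.AnabelianGeometry.SemiGraphs.TemperedReconstructionR2bHomSourceHalvesAt
import Literature.AnabelianGeometry.SemiGraphs.TemperedReconstructionCor39UpToTwistAssemblyAt
import Literature.AnabelianGeometry.SemiGraphs.TemperedReconstructionCor39UpToTwistProofs
import Literature.AnabelianGeometry.SemiGraphs.TemperedReconstructionCor39LocallyFinite
import Literature.AnabelianGeometry.SemiGraphs.TemperedReconstructionCor39UpToTwistRefutation
import HarnessLib

/-!
# [SemiAnbd] Corollary 3.9 (b), up to twist, at EVERY LOCALLY FINITE SOURCE — the asymmetric locally
# finite cell: Thm. 3.7 (iii) is needed at the TARGET only, and there it is necessary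
# (row «COR39b@LOCFIN-SOURCE-FREE», file 3/3)

Mochizuki, *Semi-graphs of anabelioids*, Publ. RIMS **42** (2006), §3, Corollary 3.9 and its proof,
manuscript pp. 42–43 (proof p. 43 l. 13–15: "[again by Theorem 3.7, (iii), (iv)]")
[cite: MochizukiSemiAnbd2006, Cor 3.9 pp.42-43].

PROOF-ONLY file (abc-iut cell, layer L3, seat abc-iut-L3-t10 gen 8; 0 definitions, no named fact; LF-SGA
cell F-1710 / F-2771).  The cell's per-pair closers of record for Cor. 3.9 up to twist (`cor39UpToTwistAt`,
`cor39CompatUpToTwistAt`, abc-iut-w4-d080) take Thm. 3.7 (iii) AT `G` AND AT `H`; this lineage's locally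
finite form (`cor39UpToTwistAt_of_isLocallyFinite`, p455767) accordingly took the residual (CE) «every
compact element is verticial» at BOTH graphs.  For CLAUSE (b) — every compatibly quasi-geometric
`φ : π₁^temp(G) → π₁^temp(H)` is induced up to twist by a locally open `F : G → H`, unique on underlying
semi-graphs — the source-side input is idle: by files 1/3–2/3 the (b)-chain uses at the source only the two
halves of Thm. 3.7 (iv) that HOLD at every locally finite graph (abc-iut-w6-d062).  Hence:

* `cor39b_upToTwist_baseAt_of_sourceHalves` / `cor39b_compatUpToTwistAt_of_sourceHalves` — (b) with FULL
  uniqueness of `F.base`, at the pair, from `CompactInVerticialAt ℋ` and the two source halves (def-free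
  currency of abc-iut-w4-d080 and the named currency `Hom.InducesUpToTwist`);
* `cor39b_upToTwist_baseAt_of_isLocallyFinite_source (hlf𝒢) (hℋiii : CompactInVerticialAt ℋ)` — **(b) at
  EVERY LOCALLY FINITE source**, with the finite-target and (CE)-locally-finite-target specialisations;
* `thetaRayFreeProP_cor39b_upToTwist_baseAt` / `…_and_not_compactInVerticialAt` — (b) HOLDS with source
  abc-iut-L3-d1's `𝒢_θ(p, n)` towards every Thm-3.7(iii) target, although Thm. 3.7 (iii) FAILS at `𝒢_θ`
  (abc-iut-L3-d4): exotic (anchor-free) maximal compact subgroups of the SOURCE never obstruct (b);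
* `not_forall_isLocallyFinite_cor39b` — at the TARGET, Thm. 3.7 (iii) CANNOT be weakened to local
  finiteness: the At-form of abc-iut-f-175's witness (p453900 / p454761: `OneVertex.graph F̂₂⁽²⁾ → 𝒢_θ(2, k ↦ k+1)`,
  `φ = ζ ∘ χ_a` onto the escaping procyclic maximal compact subgroup) is a pair of LOCALLY FINITE Cor-3.9
  graphs at which (b) fails; contrast `forall_isLocallyFinite_source_cor39b_of_compactInVerticialAt_target`.

So the locally finite cell of Cor. 3.9 (b) reads: SOURCE locally finite (nothing more) × TARGET Thm. 3.7
(iii) ⇒ PROVED; TARGET merely locally finite ⇒ REFUTED.  (Clause (a) is not touched here: its source-side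
use of (iii)/(iv) is genuine.)  HONEST FRAMING: OUR rendering at OUR typed objects; outside the [IUTchIII]
Cor. 3.12 cone (every print consumer of Cor. 3.9 has a finite dual graph, where everything here is a
theorem of the finite files); nothing asserts abc proved or refuted; typed ≠ proved.
-/

open CategoryTheory Topology

namespace Literature.AnabelianGeometry.SemiGraphs

namespace ProfiniteSemiGraph

universe u

variable {𝒢 ℋ : ProfiniteSemiGraph.{u}}

/-! ### Cor. 3.9 (b) AT the pair from Thm. 3.7 (iii) at the TARGET and the two halves at the SOURCE -/

/-- **[SemiAnbd] Cor. 3.9, clause (b), at the pair `(G, H)` — existence of the locally open morphism inducing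
`φ` up to twist, with uniqueness of its underlying morphism of semi-graphs — from Thm. 3.7 (iii) AT THE TARGET
`H` and, at the source, ONLY the two halves (hvm) «verticial ⇒ maximal compact», (hei) «edge-like =
intersection of two distinct maximal compacts»** (def-free currency of abc-iut-w4-d080; (R2′) by
`quasiGeometricGraphDataCompatAt_of_sourceHalves`, (R3) at `H` by abc-iut-w4-d064's
`chartPullbackWith_iso_of_compatibleAt`, uniqueness unconditional by `base_eq_of_exists_chartPullbackWith_iso'`).
[cite: MochizukiSemiAnbd2006, Cor 3.9 pp.42-43] -/
theorem cor39b_upToTwist_baseAt_of_sourceHalves (hℋiii : CompactInVerticialAt ℋ)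
    (h𝒢 : Cor39Hypotheses 𝒢) (hℋ : Cor39Hypotheses ℋ) (c𝒢 : TemperedPiChart 𝒢) (cℋ : TemperedPiChart ℋ)
    (hvm𝒢 : ∀ (v : 𝒢.graph.Vertex) (K : Subgroup c𝒢.G), K ∈ verticialSubgroups c𝒢 v →
      IsMaximalCompactSubgroup K)
    (hei𝒢 : ∀ (e : 𝒢.graph.Edge) (L : Subgroup c𝒢.G), 𝒢.graph.IsClosedEdge e →
      L ∈ edgeLikeSubgroups c𝒢 e → L ≠ ⊥ →
        ∃ K₁ K₂ : Subgroup c𝒢.G, IsMaximalCompactSubgroup K₁ ∧ IsMaximalCompactSubgroup K₂ ∧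
          K₁ ≠ K₂ ∧ L = K₁ ⊓ K₂)
    (φ : c𝒢.G →ₜ* cℋ.G) (hφ : IsCompatiblyQuasiGeometric φ) :
    ∃ F : Hom 𝒢 ℋ, F.IsLocallyOpen ∧
      (∃ θ : F.ConjugatorFamily, Nonempty (F.chartPullbackWith θ c𝒢 cℋ ≅ BTemp.res φ)) ∧
      ∀ F' : Hom 𝒢 ℋ, F'.IsLocallyOpen →
        (∃ θ' : F'.ConjugatorFamily, Nonempty (F'.chartPullbackWith θ' c𝒢 cℋ ≅ BTemp.res φ)) →
          F'.base = F.base := by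
  obtain ⟨F, hF, hV, hE⟩ :=
    quasiGeometricGraphDataCompatAt_of_sourceHalves hℋiii h𝒢 hℋ c𝒢 cℋ hvm𝒢 hei𝒢 φ hφ
  have hind : ∃ θ : F.ConjugatorFamily, Nonempty (F.chartPullbackWith θ c𝒢 cℋ ≅ BTemp.res φ) :=
    chartPullbackWith_iso_of_compatibleAt hℋiii h𝒢 hℋ c𝒢 cℋ F φ hF hV hE
  exact ⟨F, hF, hind, fun F' hF' hind' =>
    base_eq_of_exists_chartPullbackWith_iso' h𝒢 hℋ c𝒢 cℋ F F' φ hF hF' hind hind'⟩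

/-- The same in the named currency `Hom.InducesUpToTwist` (abc-iut-w4-d080's `Cor39CompatUpToTwist`, clause
(b), at the pair). [cite: MochizukiSemiAnbd2006, Cor 3.9 pp.42-43] -/
theorem cor39b_compatUpToTwistAt_of_sourceHalves (hℋiii : CompactInVerticialAt ℋ)
    (h𝒢 : Cor39Hypotheses 𝒢) (hℋ : Cor39Hypotheses ℋ) (c𝒢 : TemperedPiChart 𝒢) (cℋ : TemperedPiChart ℋ)
    (hvm𝒢 : ∀ (v : 𝒢.graph.Vertex) (K : Subgroup c𝒢.G), K ∈ verticialSubgroups c𝒢 v →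
      IsMaximalCompactSubgroup K)
    (hei𝒢 : ∀ (e : 𝒢.graph.Edge) (L : Subgroup c𝒢.G), 𝒢.graph.IsClosedEdge e →
      L ∈ edgeLikeSubgroups c𝒢 e → L ≠ ⊥ →
        ∃ K₁ K₂ : Subgroup c𝒢.G, IsMaximalCompactSubgroup K₁ ∧ IsMaximalCompactSubgroup K₂ ∧
          K₁ ≠ K₂ ∧ L = K₁ ⊓ K₂)
    (φ : c𝒢.G →ₜ* cℋ.G) (hφ : IsCompatiblyQuasiGeometric φ) :
    ∃ F : Hom 𝒢 ℋ, F.IsLocallyOpen ∧ F.InducesUpToTwist c𝒢 cℋ φ ∧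
      ∀ F' : Hom 𝒢 ℋ, F'.IsLocallyOpen → F'.InducesUpToTwist c𝒢 cℋ φ → F'.base = F.base :=
  cor39b_upToTwist_baseAt_of_sourceHalves hℋiii h𝒢 hℋ c𝒢 cℋ hvm𝒢 hei𝒢 φ hφ

/-! ### Cor. 3.9 (b) at every LOCALLY FINITE source -/

/-- **[SemiAnbd] Cor. 3.9 (b), up to twist, at EVERY LOCALLY FINITE source `G` and every target `H`
satisfying Thm. 3.7 (iii)** (no Thm. 3.7 (iii)/(iv) at `G`: the two source halves hold at locally finite
graphs by abc-iut-w6-d062): every compatibly quasi-geometric `φ : π₁^temp(G) → π₁^temp(H)` is induced up to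
twist by a locally open `F : G → H`, unique on underlying semi-graphs.
[cite: MochizukiSemiAnbd2006, Cor 3.9 pp.42-43] -/
theorem cor39b_upToTwist_baseAt_of_isLocallyFinite_source (hlf𝒢 : 𝒢.graph.IsLocallyFinite)
    (hℋiii : CompactInVerticialAt ℋ) (h𝒢 : Cor39Hypotheses 𝒢) (hℋ : Cor39Hypotheses ℋ)
    (c𝒢 : TemperedPiChart 𝒢) (cℋ : TemperedPiChart ℋ) (φ : c𝒢.G →ₜ* cℋ.G)
    (hφ : IsCompatiblyQuasiGeometric φ) :
    ∃ F : Hom 𝒢 ℋ, F.IsLocallyOpen ∧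
      (∃ θ : F.ConjugatorFamily, Nonempty (F.chartPullbackWith θ c𝒢 cℋ ≅ BTemp.res φ)) ∧
      ∀ F' : Hom 𝒢 ℋ, F'.IsLocallyOpen →
        (∃ θ' : F'.ConjugatorFamily, Nonempty (F'.chartPullbackWith θ' c𝒢 cℋ ≅ BTemp.res φ)) →
          F'.base = F.base :=
  cor39b_upToTwist_baseAt_of_sourceHalves hℋiii h𝒢 hℋ c𝒢 cℋ
    (hvm_of_isLocallyFinite h𝒢.thm37Hypotheses hlf𝒢 c𝒢) (hei_of_isLocallyFinite h𝒢.thm37Hypotheses hlf𝒢 c𝒢)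
    φ hφ

/-- The same in the named currency `Hom.InducesUpToTwist`. [cite: MochizukiSemiAnbd2006, Cor 3.9 pp.42-43] -/
theorem cor39b_compatUpToTwistAt_of_isLocallyFinite_source (hlf𝒢 : 𝒢.graph.IsLocallyFinite)
    (hℋiii : CompactInVerticialAt ℋ) (h𝒢 : Cor39Hypotheses 𝒢) (hℋ : Cor39Hypotheses ℋ)
    (c𝒢 : TemperedPiChart 𝒢) (cℋ : TemperedPiChart ℋ) (φ : c𝒢.G →ₜ* cℋ.G)
    (hφ : IsCompatiblyQuasiGeometric φ) :
    ∃ F : Hom 𝒢 ℋ, F.IsLocallyOpen ∧ F.InducesUpToTwist c𝒢 cℋ φ ∧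
      ∀ F' : Hom 𝒢 ℋ, F'.IsLocallyOpen → F'.InducesUpToTwist c𝒢 cℋ φ → F'.base = F.base :=
  cor39b_upToTwist_baseAt_of_isLocallyFinite_source hlf𝒢 hℋiii h𝒢 hℋ c𝒢 cℋ φ hφ

/-- **Cor. 3.9 (b) at a locally finite source `G` and a FINITE target `H`** (Thm. 3.7 (iii) at `H` by
abc-iut-L3-t8's `compactInVerticialAt_of_finiteGraph`) — hypothesis-free beyond the hypotheses of Cor. 3.9
and local finiteness of `G`; the shape «an infinite locally finite graph of anabelioids mapping to / covering
a finite one». [cite: MochizukiSemiAnbd2006, Cor 3.9 pp.42-43] -/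
theorem cor39b_upToTwist_baseAt_of_isLocallyFinite_of_finite (hlf𝒢 : 𝒢.graph.IsLocallyFinite)
    [Finite ℋ.graph.Vertex] [Finite ℋ.graph.Edge] (h𝒢 : Cor39Hypotheses 𝒢) (hℋ : Cor39Hypotheses ℋ)
    (c𝒢 : TemperedPiChart 𝒢) (cℋ : TemperedPiChart ℋ) (φ : c𝒢.G →ₜ* cℋ.G)
    (hφ : IsCompatiblyQuasiGeometric φ) :
    ∃ F : Hom 𝒢 ℋ, F.IsLocallyOpen ∧
      (∃ θ : F.ConjugatorFamily, Nonempty (F.chartPullbackWith θ c𝒢 cℋ ≅ BTemp.res φ)) ∧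
      ∀ F' : Hom 𝒢 ℋ, F'.IsLocallyOpen →
        (∃ θ' : F'.ConjugatorFamily, Nonempty (F'.chartPullbackWith θ' c𝒢 cℋ ≅ BTemp.res φ)) →
          F'.base = F.base :=
  cor39b_upToTwist_baseAt_of_isLocallyFinite_source hlf𝒢 compactInVerticialAt_of_finiteGraph h𝒢 hℋ c𝒢 cℋ
    φ hφ

/-- **Cor. 3.9 (b) at a pair of LOCALLY FINITE graphs where only the TARGET satisfies (CE) «every compact
element is verticial»** (Thm. 3.7 (iii) at `H` by abc-iut-w6-d062's elementwise iff; compare the symmetric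
`cor39UpToTwistAt_of_isLocallyFinite` of this lineage (p455767), which took (CE) at BOTH graphs).
[cite: MochizukiSemiAnbd2006, Cor 3.9 pp.42-43] -/
theorem cor39b_upToTwist_baseAt_of_isLocallyFinite_of_forall_mem (hlf𝒢 : 𝒢.graph.IsLocallyFinite)
    (hlfℋ : ℋ.graph.IsLocallyFinite)
    (hceℋ : ∀ (c : TemperedPiChart ℋ) (K : Subgroup c.G), IsCompact (K : Set c.G) →
      ∀ g ∈ K, ∃ (v : ℋ.graph.Vertex) (H : Subgroup c.G), H ∈ verticialSubgroups c v ∧ g ∈ H)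
    (h𝒢 : Cor39Hypotheses 𝒢) (hℋ : Cor39Hypotheses ℋ) (c𝒢 : TemperedPiChart 𝒢)
    (cℋ : TemperedPiChart ℋ) (φ : c𝒢.G →ₜ* cℋ.G) (hφ : IsCompatiblyQuasiGeometric φ) :
    ∃ F : Hom 𝒢 ℋ, F.IsLocallyOpen ∧
      (∃ θ : F.ConjugatorFamily, Nonempty (F.chartPullbackWith θ c𝒢 cℋ ≅ BTemp.res φ)) ∧
      ∀ F' : Hom 𝒢 ℋ, F'.IsLocallyOpen →
        (∃ θ' : F'.ConjugatorFamily, Nonempty (F'.chartPullbackWith θ' c𝒢 cℋ ≅ BTemp.res φ)) →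
          F'.base = F.base :=
  cor39b_upToTwist_baseAt_of_isLocallyFinite_source hlf𝒢
    (compactInVerticialAt_of_forall_mem_of_isLocallyFinite hlfℋ hceℋ) h𝒢 hℋ c𝒢 cℋ φ hφ

/-! ### The countermodel `𝒢_θ` as a SOURCE: (b) holds although Thm. 3.7 (iii)/(iv) fail there -/

section ThetaRaySource

variable (p : ℕ) [hp : Fact p.Prime] (n : ℕ → ℕ) {𝒦 : ProfiniteSemiGraph.{0}}

/-- **Cor. 3.9 (b), up to twist, with SOURCE abc-iut-L3-d1's countermodel `𝒢_θ(p, n)`** (locally finite,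
satisfies the hypotheses of Cor. 3.9 — abc-iut-f-176's `thetaRayFreeProP_cor39Hypotheses`) and any target
satisfying Thm. 3.7 (iii): every compatibly quasi-geometric `π₁^temp(𝒢_θ) → π₁^temp(K)` is induced up to
twist by a locally open morphism, unique on underlying semi-graphs — although the exotic (anchor-free,
procyclic) maximal compact subgroups of `π₁^temp(𝒢_θ)` defeat Thm. 3.7 (iii)/(iv) there.
[cite: MochizukiSemiAnbd2006, Cor 3.9 pp.42-43] -/
theorem thetaRayFreeProP_cor39b_upToTwist_baseAt (h𝒦iii : CompactInVerticialAt 𝒦)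
    (h𝒦 : Cor39Hypotheses 𝒦) (c : TemperedPiChart (thetaRayFreeProP p n)) (c𝒦 : TemperedPiChart 𝒦)
    (φ : c.G →ₜ* c𝒦.G) (hφ : IsCompatiblyQuasiGeometric φ) :
    ∃ F : Hom (thetaRayFreeProP p n) 𝒦, F.IsLocallyOpen ∧
      (∃ θ : F.ConjugatorFamily, Nonempty (F.chartPullbackWith θ c c𝒦 ≅ BTemp.res φ)) ∧
      ∀ F' : Hom (thetaRayFreeProP p n) 𝒦, F'.IsLocallyOpen →
        (∃ θ' : F'.ConjugatorFamily, Nonempty (F'.chartPullbackWith θ' c c𝒦 ≅ BTemp.res φ)) →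
          F'.base = F.base :=
  cor39b_upToTwist_baseAt_of_isLocallyFinite_source SemiGraph.ray_isLocallyFinite h𝒦iii
    (thetaRayFreeProP_cor39Hypotheses p n) h𝒦 c c𝒦 φ hφ

/-- **At the source `𝒢_θ(p, n)` (`n` pointwise above the identity) Cor. 3.9 (b) HOLDS towards every
Thm-3.7(iii) target WHILE Thm. 3.7 (iii) at `𝒢_θ` FAILS** (abc-iut-L3-d4's
`thetaRayFreeProP_not_compactInVerticialAt`): the source-side Thm. 3.7 (iii)/(iv) inputs of the per-pair
closers of record (`cor39UpToTwistAt`, `cor39CompatUpToTwistAt`) are idle for clause (b).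
[cite: MochizukiSemiAnbd2006, Cor 3.9 pp.42-43] -/
theorem thetaRayFreeProP_cor39b_and_not_compactInVerticialAt (hn : ∀ k, k ≤ n k)
    (h𝒦iii : CompactInVerticialAt 𝒦) (h𝒦 : Cor39Hypotheses 𝒦)
    (c : TemperedPiChart (thetaRayFreeProP p n)) (c𝒦 : TemperedPiChart 𝒦) :
    (∀ φ : c.G →ₜ* c𝒦.G, IsCompatiblyQuasiGeometric φ →
        ∃ F : Hom (thetaRayFreeProP p n) 𝒦, F.IsLocallyOpen ∧ F.InducesUpToTwist c c𝒦 φ ∧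
          ∀ F' : Hom (thetaRayFreeProP p n) 𝒦, F'.IsLocallyOpen → F'.InducesUpToTwist c c𝒦 φ →
            F'.base = F.base) ∧
      ¬ CompactInVerticialAt (thetaRayFreeProP p n) :=
  ⟨fun φ hφ => thetaRayFreeProP_cor39b_upToTwist_baseAt p n h𝒦iii h𝒦 c c𝒦 φ hφ,
    thetaRayFreeProP_not_compactInVerticialAt p n hn⟩

end ThetaRaySource

/-! ### Thm. 3.7 (iii) at the TARGET is NECESSARY: it cannot be weakened to local finiteness -/

open Literature.AnabelianGeometry.SemiGraphs.FreeProPRankTwo in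
/-- **Thm. 3.7 (iii) at the TARGET cannot be weakened to local finiteness of the target** (At-form of
abc-iut-f-175's witness, p453900 / p454761): it is FALSE that at every pair of LOCALLY FINITE Cor-3.9 graphs
every compatibly quasi-geometric homomorphism is induced up to twist by a locally open morphism — at the
locally finite pair (`OneVertex.graph F̂₂⁽²⁾`, `𝒢_θ(2, k ↦ k+1)`) the homomorphism `ζ ∘ χ_a` onto the escaping
procyclic MAXIMAL compact subgroup of `π₁^temp(𝒢_θ)` (abc-iut-L3-d4) is compatibly quasi-geometric and induced
by nothing.  So in `cor39b_upToTwist_baseAt_of_isLocallyFinite_source` the input `CompactInVerticialAt ℋ`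
is load-bearing, while NO such input is needed at the source. [cite: MochizukiSemiAnbd2006, Cor 3.9 pp.42-43] -/
theorem not_forall_isLocallyFinite_cor39b :
    ¬ ∀ (𝒢 ℋ : ProfiniteSemiGraph.{0}), 𝒢.graph.IsLocallyFinite → ℋ.graph.IsLocallyFinite →
        Cor39Hypotheses 𝒢 → Cor39Hypotheses ℋ →
        ∀ (c𝒢 : TemperedPiChart 𝒢) (cℋ : TemperedPiChart ℋ) (φ : c𝒢.G →ₜ* cℋ.G),
          IsCompatiblyQuasiGeometric φ → ∃ F : Hom 𝒢 ℋ, F.IsLocallyOpen ∧ F.InducesUpToTwist c𝒢 cℋ φ := by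
  intro h
  haveI : Fact (Nat.Prime 2) := ⟨Nat.prime_two⟩
  obtain ⟨h36, ζ, h37, hmax, hnv⟩ :=
    thetaRayFreeProP_exists_maximalCompact_escaping 2 (fun k => k + 1) (fun k => Nat.le_succ k)
  obtain ⟨L⟩ := nonempty_levelFamily_grp 2
  haveI : SecondCountableTopology (Grp 2) := secondCountableTopology_grp 2
  have hℋ : Cor39Hypotheses (thetaRayFreeProP 2 fun k => k + 1) :=
    thetaRayFreeProP_cor39Hypotheses 2 fun k => k + 1
  have h𝒢 : Cor39Hypotheses (OneVertex.graph (Grp 2)) :=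
    ⟨OneVertex.prop36Hypotheses L (isSlimGroup 2), OneVertex.isTotallyEstranged, ⟨fun b => nomatch b⟩⟩
  have hlf𝒢 : (OneVertex.graph.{0} (Grp 2)).graph.IsLocallyFinite :=
    ⟨fun _ => Set.finite_empty.subset fun e _ => nomatch e⟩
  have hrange : (ζ.comp (χa 2)).toMonoidHom.range = ζ.toMonoidHom.range := by
    change (ζ.toMonoidHom.comp (χa 2).toMonoidHom).range = _
    rw [MonoidHom.range_comp, MonoidHom.range_eq_top.mpr (χa_surjective 2), ← MonoidHom.range_eq_map]
  have hmax' : IsMaximalCompactSubgroup (ζ.comp (χa 2)).toMonoidHom.range := by rw [hrange]; exact hmax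
  have hnv' : ¬ ∃ (v : ℕ) (H : Subgroup ((thetaRayFreeProP 2 fun k => k + 1).temperedPiChart h36).G),
      H ∈ verticialSubgroups ((thetaRayFreeProP 2 fun k => k + 1).temperedPiChart h36) v ∧
        (ζ.comp (χa 2)).toMonoidHom.range ≤ H := by
    rw [hrange]; exact hnv
  obtain ⟨F, -, hind⟩ := h (OneVertex.graph (Grp 2)) (thetaRayFreeProP 2 fun k => k + 1) hlf𝒢
    SemiGraph.ray_isLocallyFinite h𝒢 hℋ (OneVertex.chart L) _ (ζ.comp (χa 2))
    (isCompatiblyQuasiGeometric_of_range_isMaximalCompactSubgroup (ζ.comp (χa 2)) hmax')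
  exact not_compatV_of_range_not_le L h37 _ (ζ.comp (χa 2)) hnv' F
    (F.compat_of_inducesUpToTwist (OneVertex.chart L) _ _ hind).1

/-- **Contrast, same quantifier shape: with Thm. 3.7 (iii) at the TARGET the statement HOLDS at every locally
finite source** (`cor39b_compatUpToTwistAt_of_isLocallyFinite_source`, existence part) — the asymmetric
locally finite cell of Cor. 3.9 (b): SOURCE locally finite (nothing more), TARGET Thm. 3.7 (iii).
[cite: MochizukiSemiAnbd2006, Cor 3.9 pp.42-43] -/
theorem forall_isLocallyFinite_source_cor39b_of_compactInVerticialAt_target :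
    ∀ (𝒢 ℋ : ProfiniteSemiGraph.{u}), 𝒢.graph.IsLocallyFinite → CompactInVerticialAt ℋ →
        Cor39Hypotheses 𝒢 → Cor39Hypotheses ℋ →
        ∀ (c𝒢 : TemperedPiChart 𝒢) (cℋ : TemperedPiChart ℋ) (φ : c𝒢.G →ₜ* cℋ.G),
          IsCompatiblyQuasiGeometric φ → ∃ F : Hom 𝒢 ℋ, F.IsLocallyOpen ∧ F.InducesUpToTwist c𝒢 cℋ φ :=
  fun _ _ hlf𝒢 hℋiii h𝒢 hℋ c𝒢 cℋ φ hφ => by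
    obtain ⟨F, hF, hind, -⟩ :=
      cor39b_compatUpToTwistAt_of_isLocallyFinite_source hlf𝒢 hℋiii h𝒢 hℋ c𝒢 cℋ φ hφ
    exact ⟨F, hF, hind⟩

end ProfiniteSemiGraph

end Literature.AnabelianGeometry.SemiGraphs
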